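import Mathlib
import HarnessLib
import Summits.KontsevichZagierPeriods.KontsevichZagierPeriods.Theorems.SoloInformedGaussMultFive

/-!
# SoloInformed — Gauss quintuplication at level 25 becomes derivable WITH A CATALYST once the
multiplication move is adjoined: an explicit ten-move chain, its class decomposition, and the
augmentation invariant that forbids a catalyst-free chain (kernel certificate)

Context (paper/main.md §7 (c6)(xi), solo-informed). `SoloInformedGaussMultFive` showed that the exponent
vector `t₂₅ = e₁+e₆+e₁₁-e₄-e₅-e₉` of Gauss's multiplication formula of index `5` at `x = 1/25` — the
`Rung₃` identity `u = α v'`, `u = B(1/25,6/25)·B(7/25,11/25)`, `v' = B(9/25,4/25)·B(13/25,5/25)` — is NOT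
in the two-term lattice `V_lin(25)` (`soloInformed_gauss5_not_twoTerm`): no chain of Dirichlet
refactorisations (D) `B(p,q)B(p+q,c) = B(q,c)B(q+c,p)` and ℚ̄-proportionalities between two Beta values
(E1, equal CM type; decided granted Huber–Wüstholz) joins `u` to `v'`.

Here we enlarge the calculus by the MULTIPLICATION MOVE of index `5` in Beta form,
`∏_{k<5} B(x+k/5, s) = 5^{5s} · B(5x,5s) · ∏_{j=1}^{4} B(js, s)` (Gauss; taken as a formal move — this
file certifies combinatorics and class bookkeeping only), and record three kernel facts.

(1) CLASS LEVEL. `t₂₅ = g + ρ₁ + ρ₂` where `g` is the class of the multiplication move at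
`(x,s) = (1/25,4/25)` and `ρ₁ = vec B(1,15) - vec B(1,9)`, `ρ₂ = vec B(1,20) - vec B(1,4)` are two-term
generators (rotations of one triple, equal CM type): `soloInformed_gauss5_decomp25`; hence
`t₂₅ ∈ V_lin(25) + ℤ·{multiplication classes}` (`soloInformed_gauss5_mem_twoTerm_sup_mult25`) although
`t₂₅ ∉ V_lin(25)`. The multiplication classes are differences of two distribution vectors
(`soloInformed_gauss5Vec25_dist`), so they are standard.

(2) SYMBOL LEVEL — A CATALYTIC CHAIN. With the catalyst `C = B(5,20)B(4,4)B(4,8)B(4,12)B(4,16)` (the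
right-hand side of the multiplication move at `(1/25,4/25)`; numerators over `25`) the state `u·C` is
joined to `v'·C` by TEN moves — seven Dirichlet refactorisations, the two two-term steps `B(1,15) ↦ B(1,9)`,
`B(1,20) ↦ B(1,4)`, and one multiplication move (`soloInformed_gauss25_chain_valid`, by `decide` on an
explicit move list with a checker that verifies admissibility of every move and multiset bookkeeping of
every state). Reading each move as an identity of real numbers up to an explicit factor in `ℚ̄^×`
(D: a positive rational, `= 1` unless numerators wrap past `25`; E1: Wolfart–Wüstholz, resp. `Rung₂` granted
H–W, `soloInformed_volumeRung_le_two`; multiplication: `5^{5s}`), the chain proves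
`⟦u⟧·⟦C⟧ = α·⟦v'⟧·⟦C⟧` in the ring of formal periods modulo accessible identities (granted H–W), with
`α = 4·5^{3/10} sin(4π/25) sin(9π/25)`. What it does NOT give is `⟦u⟧ = α⟦v'⟧`: that needs CANCELLATION of
`⟦C⟧`, which the calculus does not supply (numerically `C > 0` cancels trivially — the issue is formal).

(3) WHY A CATALYST IS FORCED — the augmentation invariant. `ε(v) = Σ_{x ≠ 0} v(x)` is additive, takes the
value `1` on a genuine Beta symbol and `2` on a reflection-type symbol `B(a,-a)` (`soloInformed_eps25_betaVec`),
is unchanged by D moves (class-neutral: `soloInformed_dirichlet25_class`), by E1 moves (both symbols genuine)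
and by multiplication moves, whose two sides have equal `ε ≥ 5` (`soloInformed_eps25_gauss5Sides`). A
catalyst-free chain from `u` (`ε = 2`, `soloInformed_eps25_gaussUV`) therefore only visits states with
`ε = 2`, i.e. with at most two symbols, on which no multiplication move (five symbols out) can act; by
`soloInformed_gauss5_not_twoTerm` the remaining moves cannot reach `v'`. So inside the enlarged calculus
Gauss-at-`25` is derivable ONLY catalytically. (Search data, not formalised: the E1/D-component of `u` has
exactly `24` states at level `25`; the chain above was found by breadth-first search, `work/s72/catalytic.py`.)
-/

namespace Summit.KontsevichZagierPeriods.KontsevichZagierPeriods.Theorems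

/-! ## States and their classes -/

/-- The class (exponent vector over `ℤ/25`) of a state = a list of Beta symbols `B(a/25,b/25)`. -/
def soloInformedStateVec25 (S : List (ZMod 25 × ZMod 25)) : ZMod 25 → ℤ :=
  fun x => (S.map fun p => soloInformedBetaVec 25 p.1 p.2 x).sum

/-- Left side `{B(x + k/5, s)}_{k<5}` of the multiplication move of index `5` (numerators over `25`). -/
def soloInformedGauss5Left25 (x s : ZMod 25) : List (ZMod 25 × ZMod 25) :=
  [(x, s), (x + 5, s), (x + 10, s), (x + 15, s), (x + 20, s)]

/-- Right side `{B(5x,5s)} ∪ {B(js,s)}_{j=1..4}` of the multiplication move of index `5`. -/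
def soloInformedGauss5Right25 (x s : ZMod 25) : List (ZMod 25 × ZMod 25) :=
  [(5 * x, 5 * s), (s, s), (2 * s, s), (3 * s, s), (4 * s, s)]

/-- The class of the multiplication move `GM₅(x,s)`: `vec(left) - vec(right)`. -/
def soloInformedGauss5Vec25 (x s : ZMod 25) : ZMod 25 → ℤ :=
  soloInformedStateVec25 (soloInformedGauss5Left25 x s) -
    soloInformedStateVec25 (soloInformedGauss5Right25 x s)

/-! ## Moves and the chain checker -/

/-- A move of the enlarged Beta calculus at level `25`:
`inl (p,q,c)` = Dirichlet refactorisation `{B(p,q), B(p+q,c)} → {B(q,c), B(q+c,p)}`;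
`inr (inl ((a,b),(a',b')))` = two-term step `B(a,b) ↦ B(a',b')` (equal CM type);
`inr (inr (x,s))` = multiplication move of index `5`, left side ↦ right side. -/
abbrev SoloInformedMove25 : Type :=
  (ZMod 25 × ZMod 25 × ZMod 25) ⊕ ((ZMod 25 × ZMod 25) × (ZMod 25 × ZMod 25)) ⊕ (ZMod 25 × ZMod 25)

/-- Symbols removed by a move. -/
def soloInformedMoveOut25 : SoloInformedMove25 → List (ZMod 25 × ZMod 25)
  | .inl (p, q, c) => [(p, q), (p + q, c)]
  | .inr (.inl ((a, b), _)) => [(a, b)]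
  | .inr (.inr (x, s)) => soloInformedGauss5Left25 x s

/-- Symbols inserted by a move. -/
def soloInformedMoveIn25 : SoloInformedMove25 → List (ZMod 25 × ZMod 25)
  | .inl (p, q, c) => [(q, c), (q + c, p)]
  | .inr (.inl (_, (a', b'))) => [(a', b')]
  | .inr (.inr (x, s)) => soloInformedGauss5Right25 x s

/-- Admissibility: every symbol touched is a genuine Beta value (no numerator `≡ 0`; for D the products
`B(p+q,c)`, `B(q+c,p)` may be of reflection type), a two-term step joins two genuine non-reflection symbols
of equal CM type (the criterion for `B(a,b)/B(a',b') ∈ ℚ̄`), and a multiplication move is non-degenerate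
(`x, s ∉ (1/5)ℤ`). -/
def soloInformedMoveOK25 : SoloInformedMove25 → Bool
  | .inl (p, q, c) => p ≠ 0 ∧ q ≠ 0 ∧ c ≠ 0 ∧ p + q ≠ 0 ∧ q + c ≠ 0
  | .inr (.inl ((a, b), (a', b'))) =>
      (a ≠ 0 ∧ b ≠ 0 ∧ a + b ≠ 0) ∧ (a' ≠ 0 ∧ b' ≠ 0 ∧ a' + b' ≠ 0) ∧
        soloInformedTau25 a b = soloInformedTau25 a' b'
  | .inr (.inr (x, s)) => 5 * x ≠ 0 ∧ 5 * s ≠ 0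

/-- A Beta symbol as an unordered pair (`B(a,b) = B(b,a)`): normal form with `a ≤ b`. -/
def soloInformedNormSym25 (p : ZMod 25 × ZMod 25) : ZMod 25 × ZMod 25 :=
  if p.1.val ≤ p.2.val then p else (p.2, p.1)

/-- Normalised state. -/
def soloInformedNorm25 (S : List (ZMod 25 × ZMod 25)) : List (ZMod 25 × ZMod 25) :=
  S.map soloInformedNormSym25

/-- Equality of states as multisets of unordered symbols (by counting). -/
def soloInformedSameState25 (S T : List (ZMod 25 × ZMod 25)) : Bool :=
  (soloInformedNorm25 S ++ soloInformedNorm25 T).all fun p =>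
    (soloInformedNorm25 S).count p == (soloInformedNorm25 T).count p

/-- One step `S →ₘ T`: `m` admissible, `out(m) ⊆ S`, and `T = S - out(m) + in(m)` as multisets. -/
def soloInformedStep25 (S : List (ZMod 25 × ZMod 25)) (m : SoloInformedMove25)
    (T : List (ZMod 25 × ZMod 25)) : Bool :=
  let rest := (soloInformedNorm25 S).diff (soloInformedNorm25 (soloInformedMoveOut25 m))
  soloInformedMoveOK25 m && soloInformedSameState25 S (soloInformedMoveOut25 m ++ rest) &&
    soloInformedSameState25 T (soloInformedMoveIn25 m ++ rest)

/-- A chain from `S`: a list of (move, resulting state) pairs, each a valid step from the previous state. -/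
def soloInformedChain25 : List (ZMod 25 × ZMod 25) →
    List (SoloInformedMove25 × List (ZMod 25 × ZMod 25)) → Bool
  | _, [] => true
  | S, (m, T) :: rest => soloInformedStep25 S m T && soloInformedChain25 T rest

/-! ## The data: `u`, `v'`, the catalyst and the ten-move chain -/

/-- `u = B(1/25,6/25)·B(7/25,11/25)` (`= Γ(1/25)Γ(6/25)Γ(11/25)/Γ(18/25)`). -/
def soloInformedGaussU25 : List (ZMod 25 × ZMod 25) := [(1, 6), (7, 11)]

/-- `v' = B(9/25,4/25)·B(13/25,5/25)` (`= Γ(4/25)Γ(5/25)Γ(9/25)/Γ(18/25)`), as in `soloInformedGauss5`. -/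
def soloInformedGaussV25 : List (ZMod 25 × ZMod 25) := [(9, 4), (13, 5)]

/-- The catalyst `C = B(5,20)·B(4,4)·B(4,8)·B(4,12)·B(4,16)` (numerators over `25`). -/
def soloInformedCatalyst25 : List (ZMod 25 × ZMod 25) := [(5, 20), (4, 4), (4, 8), (4, 12), (4, 16)]

/-- The catalyst is the right-hand side of the multiplication move at `(x,s) = (1/25, 4/25)` (as a multiset
of unordered symbols). -/
theorem soloInformed_catalyst25_eq :
    soloInformedSameState25 soloInformedCatalyst25 (soloInformedGauss5Right25 1 4) = true := by decide

/-- The ten-move chain `u·C → … → v'·C`: seven Dirichlet moves, two two-term steps (`B(1,15) ↦ B(1,9)`,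
`B(1,20) ↦ B(1,4)`), one multiplication move (step 9). -/
def soloInformedGaussChain25 : List (SoloInformedMove25 × List (ZMod 25 × ZMod 25)) :=
  [ (.inl (6, 1, 11),             [(1, 11), (6, 12), (5, 20), (4, 4), (4, 8), (4, 12), (4, 16)]),
    (.inl (1, 11, 4),             [(1, 15), (4, 11), (6, 12), (5, 20), (4, 4), (4, 8), (4, 16)]),
    (.inl (8, 4, 6),              [(1, 15), (4, 11), (4, 6), (8, 10), (5, 20), (4, 4), (4, 16)]),
    (.inr (.inl ((1, 15), (1, 9))), [(1, 9), (4, 11), (4, 6), (8, 10), (5, 20), (4, 4), (4, 16)]),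
    (.inl (9, 1, 8),              [(1, 8), (9, 9), (4, 11), (4, 6), (5, 20), (4, 4), (4, 16)]),
    (.inl (4, 4, 1),              [(1, 4), (4, 5), (9, 9), (4, 11), (4, 6), (5, 20), (4, 16)]),
    (.inl (4, 1, 20),             [(1, 20), (4, 21), (4, 5), (9, 9), (4, 11), (4, 6), (4, 16)]),
    (.inr (.inl ((1, 20), (1, 4))), [(1, 4), (4, 21), (4, 5), (9, 9), (4, 11), (4, 6), (4, 16)]),
    (.inr (.inr (1, 4)),          [(4, 5), (9, 9), (5, 20), (4, 4), (4, 8), (4, 12), (4, 16)]),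
    (.inl (5, 4, 9),              [(9, 4), (13, 5), (5, 20), (4, 4), (4, 8), (4, 12), (4, 16)]) ]

/-- MAIN (symbol level): the chain is valid — every move admissible, every state the correct multiset. -/
theorem soloInformed_gauss25_chain_valid :
    soloInformedChain25 (soloInformedGaussU25 ++ soloInformedCatalyst25) soloInformedGaussChain25 = true := by
  decide

/-- It starts at `u·C` (by construction) and ends at `v'·C`. -/
theorem soloInformed_gauss25_chain_ends :
    (soloInformedGaussChain25.getLast?.map Prod.snd) = some (soloInformedGaussV25 ++ soloInformedCatalyst25) := by
  decide

/-- Before the multiplication move (state 8) the state is `v'' · L` with `L` the LEFT side of the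
multiplication move at `(1/25,4/25)` and `v'' = B(4,5)B(9,9)` (one Dirichlet move from `v'`). -/
theorem soloInformed_gauss25_chain_state8 :
    ((soloInformedGaussChain25.map Prod.snd)[7]?) =
      some ([(1, 4), (4, 21), (4, 5), (9, 9), (4, 11), (4, 6), (4, 16)] : List (ZMod 25 × ZMod 25)) ∧
    soloInformedSameState25 [(1, 4), (4, 21), (4, 5), (9, 9), (4, 11), (4, 6), (4, 16)]
      ([(4, 5), (9, 9)] ++ soloInformedGauss5Left25 1 4) = true := by
  constructor <;> decide

/-- The class of the chain's endpoints differs by the Gauss vector: `vec(u·C) - vec(v'·C) = t₂₅`. -/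
theorem soloInformed_gauss25_chain_class :
    soloInformedStateVec25 (soloInformedGaussU25 ++ soloInformedCatalyst25) -
      soloInformedStateVec25 (soloInformedGaussV25 ++ soloInformedCatalyst25) = soloInformedGauss5 := by
  funext x; revert x; decide

/-! ## Semantics of the three move kinds at class level -/

/-- A Dirichlet move is class-neutral: both sides have class `e_p + e_q + e_c - e_{p+q+c}`
(the exact identity `Γ(p)Γ(q)Γ(c)/Γ(p+q+c)` written two ways). -/
theorem soloInformed_dirichlet25_class (p q c : ZMod 25) (hpq : p + q ≠ 0) (hqc : q + c ≠ 0) :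
    soloInformedStateVec25 [(p, q), (p + q, c)] = soloInformedStateVec25 [(q, c), (q + c, p)] := by
  funext x
  have h1 : (if p + q = x ∧ x ≠ 0 then (1:ℤ) else 0) = if p + q = x then 1 else 0 := by
    by_cases h : p + q = x
    · subst h; simp [hpq]
    · simp [h]
  have h2 : (if q + c = x ∧ x ≠ 0 then (1:ℤ) else 0) = if q + c = x then 1 else 0 := by
    by_cases h : q + c = x
    · subst h; simp [hqc]
    · simp [h]
  have h3 : q + c + p = p + q + c := by ring
  simp only [soloInformedStateVec25, List.map, List.sum_cons, List.sum_nil, soloInformedBetaVec, h1, h2, h3]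
  ring

/-- A two-term step changes the class by a generator of the two-term lattice `V_lin(25)`. -/
theorem soloInformed_twoTerm25_class (a b a' b' : ZMod 25)
    (h : soloInformedMoveOK25 (.inr (.inl ((a, b), (a', b')))) = true) :
    soloInformedStateVec25 [(a, b)] - soloInformedStateVec25 [(a', b')] ∈ soloInformedTwoTermLattice25 := by
  have hv : ∀ c d : ZMod 25, soloInformedStateVec25 [(c, d)] = soloInformedBetaVec 25 c d := by
    intro c d; funext x; simp [soloInformedStateVec25]
  rw [hv, hv]
  simp only [soloInformedMoveOK25, decide_eq_true_eq] at h
  obtain ⟨hab, ha'b', htau⟩ := h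
  exact Submodule.subset_span ⟨a, b, a', b', hab, ha'b', htau, rfl⟩

set_option maxHeartbeats 4000000 in
/-- A (non-degenerate) multiplication move changes the class by a difference of two DISTRIBUTION vectors:
`vec(left) - vec(right) = D(5,x) - D(5,x+s)`, `D(5,y) = 𝟙_{≡ y (5)} - e_{5y}`. -/
theorem soloInformed_gauss5Vec25_dist : ∀ x s : ZMod 25, 5 * x ≠ 0 → 5 * s ≠ 0 →
    soloInformedGauss5Vec25 x s = soloInformedDistVec 25 5 x - soloInformedDistVec 25 5 (x + s) := by
  decide

/-- Hence multiplication classes are standard (`∈ L₂₅`). -/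
theorem soloInformed_gauss5Vec25_mem_std (x s : ZMod 25) (hx : 5 * x ≠ 0) (hs : 5 * s ≠ 0) :
    soloInformedGauss5Vec25 x s ∈ soloInformedStdLattice 25 := by
  rw [soloInformed_gauss5Vec25_dist x s hx hs]
  exact Submodule.sub_mem _ (soloInformed_distVec_mem 25 (by decide) x)
    (soloInformed_distVec_mem 25 (by decide) (x + s))

/-! ## The class decomposition of the Gauss vector -/

/-- MAIN (class level): `t₂₅ = GM₅(1/25,4/25) + [B(1,15) - B(1,9)] + [B(1,20) - B(1,4)]`. -/
theorem soloInformed_gauss5_decomp25 :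
    soloInformedGauss5 = soloInformedGauss5Vec25 1 4 +
      (soloInformedBetaVec 25 1 15 - soloInformedBetaVec 25 1 9) +
      (soloInformedBetaVec 25 1 20 - soloInformedBetaVec 25 1 4) := by
  funext x; revert x; decide

/-- The two correction terms are two-term generators: rotations of the triples `{1,15,9}`, `{1,20,4}`
have equal CM type. -/
theorem soloInformed_gauss5_decomp25_tau :
    soloInformedTau25 1 15 = soloInformedTau25 1 9 ∧ soloInformedTau25 1 20 = soloInformedTau25 1 4 := by
  decide

/-- The lattice spanned by the non-degenerate multiplication classes of index `5` at level `25`. -/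
def soloInformedMultLattice25 : Submodule ℤ (ZMod 25 → ℤ) :=
  Submodule.span ℤ {v | ∃ x s : ZMod 25, 5 * x ≠ 0 ∧ 5 * s ≠ 0 ∧ v = soloInformedGauss5Vec25 x s}

/-- `t₂₅ ∈ V_lin(25) + (multiplication classes)` — compare `soloInformed_gauss5_not_twoTerm`:
`t₂₅ ∉ V_lin(25)`. The multiplication move is exactly the missing generator. -/
theorem soloInformed_gauss5_mem_twoTerm_sup_mult25 :
    soloInformedGauss5 ∈ soloInformedTwoTermLattice25 ⊔ soloInformedMultLattice25 := by
  rw [soloInformed_gauss5_decomp25]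
  refine Submodule.add_mem _ (Submodule.add_mem _ ?_ ?_) ?_
  · exact Submodule.mem_sup_right (Submodule.subset_span ⟨1, 4, by decide, by decide, rfl⟩)
  · exact Submodule.mem_sup_left
      (Submodule.subset_span ⟨1, 15, 1, 9, by decide, by decide, soloInformed_gauss5_decomp25_tau.1, rfl⟩)
  · exact Submodule.mem_sup_left
      (Submodule.subset_span ⟨1, 20, 1, 4, by decide, by decide, soloInformed_gauss5_decomp25_tau.2, rfl⟩)

/-- … and the contrast in one statement. -/
theorem soloInformed_gauss5_catalytic_contrast :
    soloInformedGauss5 ∉ soloInformedTwoTermLattice25 ∧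
      soloInformedGauss5 ∈ soloInformedTwoTermLattice25 ⊔ soloInformedMultLattice25 :=
  ⟨soloInformed_gauss5_not_twoTerm, soloInformed_gauss5_mem_twoTerm_sup_mult25⟩

/-! ## The augmentation invariant -/

/-- The augmentation `ε(v) = Σ_{x ≠ 0} v(x)`. -/
def soloInformedEps25 : (ZMod 25 → ℤ) →ₗ[ℤ] ℤ where
  toFun v := ∑ x ∈ (Finset.univ : Finset (ZMod 25)).erase 0, v x
  map_add' u w := by simp only [Pi.add_apply, Finset.sum_add_distrib]
  map_smul' c u := by simp only [Pi.smul_apply, smul_eq_mul, RingHom.id_apply, Finset.mul_sum]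

/-- Evaluation of `ε`. -/
theorem soloInformedEps25_apply (v : ZMod 25 → ℤ) :
    soloInformedEps25 v = ∑ x ∈ (Finset.univ : Finset (ZMod 25)).erase 0, v x := rfl

set_option maxHeartbeats 4000000 in
/-- `ε` of a genuine Beta symbol is `1`, of a reflection-type symbol `B(a,-a)` is `2`. -/
theorem soloInformed_eps25_betaVec : ∀ a b : ZMod 25, a ≠ 0 → b ≠ 0 →
    soloInformedEps25 (soloInformedBetaVec 25 a b) = if a + b = 0 then 2 else 1 := by
  intro a b; rw [soloInformedEps25_apply]; revert b; revert a; decide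

/-- `ε` is additive over states. -/
theorem soloInformed_eps25_stateVec_append (S T : List (ZMod 25 × ZMod 25)) :
    soloInformedEps25 (soloInformedStateVec25 (S ++ T)) =
      soloInformedEps25 (soloInformedStateVec25 S) + soloInformedEps25 (soloInformedStateVec25 T) := by
  rw [← map_add]; congr 1; funext x; simp [soloInformedStateVec25, List.sum_append]

set_option maxHeartbeats 4000000 in
/-- The two sides of a non-degenerate multiplication move have equal augmentation, at least `5`. -/
theorem soloInformed_eps25_gauss5Sides : ∀ x s : ZMod 25, 5 * x ≠ 0 → 5 * s ≠ 0 →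
    soloInformedEps25 (soloInformedStateVec25 (soloInformedGauss5Left25 x s)) =
        soloInformedEps25 (soloInformedStateVec25 (soloInformedGauss5Right25 x s)) ∧
      5 ≤ soloInformedEps25 (soloInformedStateVec25 (soloInformedGauss5Left25 x s)) := by
  intro x s; rw [soloInformedEps25_apply, soloInformedEps25_apply]; revert s; revert x; decide

/-- `ε(u) = ε(v') = 2`, while the catalysed endpoints have `ε = 8`. -/
theorem soloInformed_eps25_gaussUV :
    soloInformedEps25 (soloInformedStateVec25 soloInformedGaussU25) = 2 ∧
      soloInformedEps25 (soloInformedStateVec25 soloInformedGaussV25) = 2 ∧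
      soloInformedEps25 (soloInformedStateVec25 (soloInformedGaussU25 ++ soloInformedCatalyst25)) = 8 := by
  refine ⟨?_, ?_, ?_⟩ <;> (rw [soloInformedEps25_apply]; decide)

end Summit.KontsevichZagierPeriods.KontsevichZagierPeriods.Theorems
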